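import Mathlib.Data.Matrix.Mul
import Mathlib.LinearAlgebra.Matrix.Notation
import Mathlib.Data.ZMod.Basic
import Mathlib.Tactic
import HarnessLib

/-!
# K1⁺ brick 3 — vector-valued crossed homomorphisms of a group mapping onto `GL₂(ℤ/2^m)`: the centre and the `S₃`-top

Crux U1 `KolyvaginBoundedDefectAtTwo` (stmt-BirchSwinnertonDyer-28083), LINE 17, support statement K1⁺ `PhantomLineAtTwo` (pen bsd-idea-1 g13;
memo HOME `line17/K1_row_memo_g13.md` § v3, steps (1)–(2)). Width seat `bsd-line-krr2-p2` g17; `--supports … --as helper`. PURE ALGEBRA.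

Setting (hypotheses, no definitions): a group `Γ`, a matrix-valued multiplicative map `ρ : Γ → M₂(ℤ/2^m)` (`ρ (g h) = ρ g ρ h`, `ρ 1 = 1`)
— in the application `ρ` is the Galois action on `E[2^(k+1)] ≃ (ℤ/2^(k+1))²` in a frame — and a vector-valued crossed homomorphism
`ψ : Γ → (ℤ/2^m)²`, `ψ (g h) = ψ g + ρ g ψ h`, vanishing on `ker ρ` (an INFLATED class). "Surjectivity" enters only through named elements:
`z` with `ρ z = −1`, `s` with `ρ s = S = [[0,1],[1,0]]`, `t` with `ρ t = U = [[1,1],[0,1]]`.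

§1 bookkeeping; §2 **Sah's identity** `2 ψ g = ψ z − ρ g ψ z` and the step-(1) NORMAL FORM (coboundary shift to a `2`-torsion-valued
cocycle vanishing at `z`); §3 congruences `A ≡ B mod 2` as `∃ C, A = B + 2 • C`, reduction to `M₂(𝔽₂)`, the six residues of an invertible
matrix; §4 **the `S₃`-top (step (2))**: a `2`-torsion-valued cocycle vanishing on `Γ(2) = {γ : ρ γ ≡ 1 mod 2}` is a coboundary
(`H¹(GL₂(𝔽₂), 𝔽₂²) = 0` by hand on `S`, `U`). Nothing here proves K1⁺, S2, U1 or BSD. [cite: LawsonWuthrich2016, Thm. 1 and §7.1]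
[cite: Sah1968, Prop. 2.7 (b)] -/

set_option autoImplicit false
-- the Theorems namespace of this sub repeats the summit name by design (D-0017 nested layout)
set_option linter.dupNamespace false

namespace Summit.BirchSwinnertonDyer.BirchSwinnertonDyer.Theorems.KolyvaginAtTwo.PhantomMatrix

open Matrix

variable {Γ : Type*} [Group Γ] {m : ℕ}

/-! ### §1 Matrix cocycles: bookkeeping -/

section Basics

variable {ρ : Γ → Matrix (Fin 2) (Fin 2) (ZMod (2 ^ m))} {ψ : Γ → Fin 2 → ZMod (2 ^ m)}

/-- `ρ g⁻¹ * ρ g = 1`. [folklore] -/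
theorem rho_inv_mul (hρ : ∀ g h, ρ (g * h) = ρ g * ρ h) (hρ1 : ρ 1 = 1) (g : Γ) : ρ g⁻¹ * ρ g = 1 := by
  rw [← hρ, inv_mul_cancel, hρ1]

/-- `ρ g * ρ g⁻¹ = 1`. [folklore] -/
theorem rho_mul_inv (hρ : ∀ g h, ρ (g * h) = ρ g * ρ h) (hρ1 : ρ 1 = 1) (g : Γ) : ρ g * ρ g⁻¹ = 1 := by
  rw [← hρ, mul_inv_cancel, hρ1]

/-- A matrix cocycle vanishes at `1`. [folklore] -/
theorem mcocycle_apply_one (hψ : ∀ g h, ψ (g * h) = ψ g + ρ g *ᵥ ψ h) (hρ1 : ρ 1 = 1) : ψ 1 = 0 := by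
  have h := hψ 1 1
  rw [mul_one, hρ1, one_mulVec] at h
  have : ψ 1 + ψ 1 = ψ 1 + 0 := by rw [add_zero]; exact h.symm
  exact add_left_cancel this

/-- Value at an inverse. [folklore] -/
theorem mcocycle_apply_inv (hψ : ∀ g h, ψ (g * h) = ψ g + ρ g *ᵥ ψ h) (hρ1 : ρ 1 = 1) (g : Γ) :
    ψ g⁻¹ = -(ρ g⁻¹ *ᵥ ψ g) := by
  have h := hψ g⁻¹ g
  rw [inv_mul_cancel, mcocycle_apply_one hψ hρ1] at h
  exact eq_neg_of_add_eq_zero_left h.symm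

/-- Right translation by an element where `ψ` vanishes. [folklore] -/
theorem mcocycle_mul_right (hψ : ∀ g h, ψ (g * h) = ψ g + ρ g *ᵥ ψ h) {n : Γ} (hψn : ψ n = 0) (g : Γ) :
    ψ (g * n) = ψ g := by
  rw [hψ, hψn, mulVec_zero, add_zero]

/-- Left translation by an element of `ker ρ` where `ψ` vanishes. [folklore] -/
theorem mcocycle_mul_left (hψ : ∀ g h, ψ (g * h) = ψ g + ρ g *ᵥ ψ h) {n : Γ} (hn : ρ n = 1) (hψn : ψ n = 0)
    (g : Γ) : ψ (n * g) = ψ g := by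
  rw [hψ, hψn, hn, one_mulVec, zero_add]

/-- A matrix cocycle vanishing on `ker ρ` only depends on `ρ g`. [folklore] -/
theorem mcocycle_eq_of_rho_eq (hρ : ∀ g h, ρ (g * h) = ρ g * ρ h) (hρ1 : ρ 1 = 1)
    (hψ : ∀ g h, ψ (g * h) = ψ g + ρ g *ᵥ ψ h) (hN : ∀ n, ρ n = 1 → ψ n = 0) {g g' : Γ}
    (hgg' : ρ g = ρ g') : ψ g = ψ g' := by
  have hn : ρ (g'⁻¹ * g) = 1 := by rw [hρ, hgg', rho_inv_mul hρ hρ1]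
  have : g = g' * (g'⁻¹ * g) := by group
  rw [this, mcocycle_mul_right hψ (hN _ hn)]

/-- Coboundaries `g ↦ ρ g b − b` are matrix cocycles. [folklore] -/
theorem mcoboundary_isCocycle (hρ : ∀ g h, ρ (g * h) = ρ g * ρ h) (b : Fin 2 → ZMod (2 ^ m)) (g h : Γ) :
    ρ (g * h) *ᵥ b - b = (ρ g *ᵥ b - b) + ρ g *ᵥ (ρ h *ᵥ b - b) := by
  rw [hρ, mulVec_sub, mulVec_mulVec]; abel

/-- Shifting by a coboundary keeps the cocycle identity. [folklore] -/
theorem mcocycle_shift (hρ : ∀ g h, ρ (g * h) = ρ g * ρ h) (hψ : ∀ g h, ψ (g * h) = ψ g + ρ g *ᵥ ψ h)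
    (b : Fin 2 → ZMod (2 ^ m)) (g h : Γ) :
    ψ (g * h) + (ρ (g * h) *ᵥ b - b) = (ψ g + (ρ g *ᵥ b - b)) + ρ g *ᵥ (ψ h + (ρ h *ᵥ b - b)) := by
  rw [hψ, mcoboundary_isCocycle hρ, mulVec_add]; abel

omit [Group Γ] in
/-- A coboundary vanishes on `ker ρ`. [folklore] -/
theorem mcoboundary_apply_ker {n : Γ} (hn : ρ n = 1) (b : Fin 2 → ZMod (2 ^ m)) : ρ n *ᵥ b - b = 0 := by
  rw [hn, one_mulVec, sub_self]

/-- The difference of two matrix cocycles is one. [folklore] -/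
theorem mcocycle_sub {ψ₁ ψ₂ : Γ → Fin 2 → ZMod (2 ^ m)} (hψ₁ : ∀ g h, ψ₁ (g * h) = ψ₁ g + ρ g *ᵥ ψ₁ h)
    (hψ₂ : ∀ g h, ψ₂ (g * h) = ψ₂ g + ρ g *ᵥ ψ₂ h) (g h : Γ) :
    ψ₁ (g * h) - ψ₂ (g * h) = (ψ₁ g - ψ₂ g) + ρ g *ᵥ (ψ₁ h - ψ₂ h) := by
  rw [hψ₁, hψ₂, mulVec_sub]; abel

/-- **Equivariance**: if `ρ γ` fixes the vector `ψ g⁻¹` then `ψ (g γ g⁻¹) = ρ g ψ γ`. [folklore] -/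
theorem mcocycle_conj (hψ : ∀ g h, ψ (g * h) = ψ g + ρ g *ᵥ ψ h) (hρ1 : ρ 1 = 1)
    (hρ : ∀ g h, ρ (g * h) = ρ g * ρ h) (g γ : Γ) (hfix : ρ γ *ᵥ ψ g⁻¹ = ψ g⁻¹) :
    ψ (g * γ * g⁻¹) = ρ g *ᵥ ψ γ := by
  rw [hψ, hψ, hρ, ← mulVec_mulVec, hfix, mcocycle_apply_inv hψ hρ1 g, mulVec_neg, mulVec_mulVec,
    rho_mul_inv hρ hρ1, one_mulVec]
  abel

/-- On elements where `ρ` fixes all values of `ψ` in play the cocycle is additive: if `ρ g ψ h = ψ h` then `ψ (g h) = ψ g + ψ h`.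
[folklore] -/
theorem mcocycle_mul_of_fix (hψ : ∀ g h, ψ (g * h) = ψ g + ρ g *ᵥ ψ h) (g h : Γ) (hfix : ρ g *ᵥ ψ h = ψ h) :
    ψ (g * h) = ψ g + ψ h := by
  rw [hψ, hfix]

end Basics

/-! ### §2 The centre: Sah's identity and the `2`-torsion normal form -/

section Centre

variable {ρ : Γ → Matrix (Fin 2) (Fin 2) (ZMod (2 ^ m))} {ψ : Γ → Fin 2 → ZMod (2 ^ m)}

/-- **Sah's identity** for matrix cocycles vanishing on `ker ρ`: if `ρ z = −1` then `2 • ψ g = ψ z − ρ g ψ z`.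
[cite: Sah1968, Prop. 2.7 (b)] -/
theorem two_smul_mcocycle_eq (hρ : ∀ g h, ρ (g * h) = ρ g * ρ h) (hρ1 : ρ 1 = 1)
    (hψ : ∀ g h, ψ (g * h) = ψ g + ρ g *ᵥ ψ h) (hN : ∀ n, ρ n = 1 → ψ n = 0) {z : Γ} (hz : ρ z = -1) (g : Γ) :
    (2 : ZMod (2 ^ m)) • ψ g = ψ z - ρ g *ᵥ ψ z := by
  have hcomm : ψ (g * z) = ψ (z * g) :=
    mcocycle_eq_of_rho_eq hρ hρ1 hψ hN (by rw [hρ, hρ, hz, mul_neg_one, neg_one_mul])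
  rw [hψ, hψ, hz, neg_mulVec, one_mulVec] at hcomm
  rw [two_smul]
  calc ψ g + ψ g = ψ g + ρ g *ᵥ ψ z + ψ g - ρ g *ᵥ ψ z := by abel
    _ = ψ z + -ψ g + ψ g - ρ g *ᵥ ψ z := by rw [hcomm]
    _ = ψ z - ρ g *ᵥ ψ z := by abel

/-- An element of `ℤ/2^m` divisible by `2` in the sense of its canonical representative is `2` times something. [folklore] -/
theorem exists_eq_two_mul_of_dvd_val {x : ZMod (2 ^ m)} (hx : 2 ∣ x.val) : ∃ c : ZMod (2 ^ m), x = 2 * c := by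
  haveI : NeZero (2 ^ m) := ⟨pow_ne_zero _ two_ne_zero⟩
  obtain ⟨k, hk⟩ := hx
  refine ⟨(k : ZMod (2 ^ m)), ?_⟩
  have : ((x.val : ℕ) : ZMod (2 ^ m)) = ((2 * k : ℕ) : ZMod (2 ^ m)) := by rw [hk]
  rwa [ZMod.natCast_zmod_val, Nat.cast_mul, Nat.cast_ofNat] at this

/-- If `2 • v = 0`-type divisibility: a vector all of whose `S`- and `U`-differences are even is even — `(R²/2R²)^{⟨S,U⟩} = 0` in element
form (`S (a₀,a₁) − (a₀,a₁) = (a₁−a₀, a₀−a₁)`, `U (a₀,a₁) − (a₀,a₁) = (a₁, 0)`). [cite: LawsonWuthrich2016, Thm. 1] -/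
theorem exists_half_of_fixed_mod_two (a : Fin 2 → ZMod (2 ^ m))
    (hS : ∃ c : Fin 2 → ZMod (2 ^ m), !![0, 1; 1, 0] *ᵥ a - a = (2 : ZMod (2 ^ m)) • c)
    (hU : ∃ c : Fin 2 → ZMod (2 ^ m), !![1, 1; 0, 1] *ᵥ a - a = (2 : ZMod (2 ^ m)) • c) :
    ∃ b : Fin 2 → ZMod (2 ^ m), a = (2 : ZMod (2 ^ m)) • b := by
  obtain ⟨c, hc⟩ := hS
  obtain ⟨d, hd⟩ := hU
  have h0 := congrFun hc 0
  have h1 := congrFun hd 0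
  simp only [Pi.sub_apply, Pi.smul_apply, smul_eq_mul, mulVec, dotProduct, Fin.sum_univ_two, of_apply, cons_val',
    cons_val_zero, cons_val_one, cons_val_fin_one, empty_val'] at h0 h1
  refine ⟨![d 0 - c 0, d 0], funext fun i ↦ ?_⟩
  fin_cases i
  · simp only [Fin.zero_eta, Pi.smul_apply, cons_val_zero, smul_eq_mul, Fin.isValue]
    linear_combination h1 - h0
  · simp only [Fin.mk_one, Pi.smul_apply, cons_val_one, cons_val_fin_one, smul_eq_mul, Fin.isValue]
    linear_combination h1

/-- **Normal form (step (1)).** For a matrix cocycle `ψ` vanishing on `ker ρ`, with `ρ z = −1`, `ρ s = S`, `ρ t = U`: some coboundary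
shift `ψ' = ψ + ∂b` is `2`-torsion-valued and vanishes at `z`. [cite: LawsonWuthrich2016, §7.1] [cite: Sah1968, Prop. 2.7 (b)] -/
theorem exists_shift_normal_form (hρ : ∀ g h, ρ (g * h) = ρ g * ρ h) (hρ1 : ρ 1 = 1)
    (hψ : ∀ g h, ψ (g * h) = ψ g + ρ g *ᵥ ψ h) (hN : ∀ n, ρ n = 1 → ψ n = 0)
    {z s t : Γ} (hz : ρ z = -1) (hs : ρ s = !![0, 1; 1, 0]) (ht : ρ t = !![1, 1; 0, 1]) :
    ∃ b : Fin 2 → ZMod (2 ^ m),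
      (∀ g, (2 : ZMod (2 ^ m)) • (ψ g + (ρ g *ᵥ b - b)) = 0) ∧ ψ z + (ρ z *ᵥ b - b) = 0 := by
  have key : ∀ g, ρ g *ᵥ ψ z - ψ z = (2 : ZMod (2 ^ m)) • (-ψ g) := fun g ↦ by
    rw [smul_neg, two_smul_mcocycle_eq hρ hρ1 hψ hN hz g]; abel
  obtain ⟨b, hb⟩ := exists_half_of_fixed_mod_two (ψ z) ⟨-ψ s, by rw [← hs]; exact key s⟩
    ⟨-ψ t, by rw [← ht]; exact key t⟩
  refine ⟨b, fun g ↦ ?_, ?_⟩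
  · rw [smul_add, two_smul_mcocycle_eq hρ hρ1 hψ hN hz g, hb, mulVec_smul, smul_sub]
    abel
  · rw [hb, hz, neg_mulVec, one_mulVec, two_smul]; abel

/-- Bookkeeping: the shift is again a cocycle vanishing on `ker ρ`. [folklore] -/
theorem shift_mcocycle (hρ : ∀ g h, ρ (g * h) = ρ g * ρ h) (hψ : ∀ g h, ψ (g * h) = ψ g + ρ g *ᵥ ψ h)
    (hN : ∀ n, ρ n = 1 → ψ n = 0) (b : Fin 2 → ZMod (2 ^ m)) :
    (∀ g h, ψ (g * h) + (ρ (g * h) *ᵥ b - b) = (ψ g + (ρ g *ᵥ b - b)) + ρ g *ᵥ (ψ h + (ρ h *ᵥ b - b))) ∧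
      ∀ n, ρ n = 1 → ψ n + (ρ n *ᵥ b - b) = 0 :=
  ⟨mcocycle_shift hρ hψ b, fun n hn ↦ by rw [hN n hn, mcoboundary_apply_ker hn, add_zero]⟩

end Centre

/-! ### §3 Reduction modulo `2` -/

section ModTwo

/-- **The kernel of `ℤ/2^m → ℤ/2` is `2·(ℤ/2^m)`** (`m ≥ 1`). [folklore] -/
theorem castHom_two_eq_zero_iff (hm : 1 ≤ m) (x : ZMod (2 ^ m)) :
    ZMod.castHom (dvd_pow_self 2 (by omega) : 2 ∣ 2 ^ m) (ZMod 2) x = 0 ↔ ∃ c : ZMod (2 ^ m), x = 2 * c := by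
  haveI : NeZero (2 ^ m) := ⟨pow_ne_zero _ two_ne_zero⟩
  constructor
  · intro h
    rw [ZMod.castHom_apply, ZMod.cast_eq_val, ZMod.natCast_eq_zero_iff] at h
    exact exists_eq_two_mul_of_dvd_val h
  · rintro ⟨c, rfl⟩
    have h2 : (2 : ZMod 2) = 0 := by decide
    rw [map_mul, map_ofNat, h2, zero_mul]

variable (φ : ZMod (2 ^ m) →+* ZMod 2)

/-- `A ≡ B (mod 2)` as `∃ C, A = B + 2 • C` is detected by the reduction map (given its kernel is `2R`). [folklore] -/
theorem map_eq_map_iff (hφ : ∀ x : ZMod (2 ^ m), φ x = 0 ↔ ∃ c : ZMod (2 ^ m), x = 2 * c)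
    (A B : Matrix (Fin 2) (Fin 2) (ZMod (2 ^ m))) :
    A.map φ = B.map φ ↔ ∃ C : Matrix (Fin 2) (Fin 2) (ZMod (2 ^ m)), A = B + (2 : ZMod (2 ^ m)) • C := by
  constructor
  · intro h
    have hij : ∀ i j, ∃ c : ZMod (2 ^ m), A i j - B i j = 2 * c := fun i j ↦ by
      rw [← hφ, map_sub, sub_eq_zero]
      exact congrFun (congrFun h i) j
    choose c hc using hij
    refine ⟨Matrix.of fun i j ↦ c i j, ?_⟩
    ext i j
    simp only [Matrix.add_apply, Matrix.smul_apply, of_apply, smul_eq_mul]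
    linear_combination hc i j
  · rintro ⟨C, rfl⟩
    ext i j
    have h2 : φ 2 = 0 := (hφ 2).mpr ⟨1, by ring⟩
    simp only [map_apply, Matrix.add_apply, Matrix.smul_apply, smul_eq_mul, map_add, map_mul, h2, zero_mul, add_zero]

/-- The reduction of `ρ g` is invertible: its determinant is `1` in `ℤ/2`. [folklore] -/
theorem det_map_rho_eq_one {ρ : Γ → Matrix (Fin 2) (Fin 2) (ZMod (2 ^ m))}
    (hρ : ∀ g h, ρ (g * h) = ρ g * ρ h) (hρ1 : ρ 1 = 1) (g : Γ) : ((ρ g).map φ).det = 1 := by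
  have h : (ρ g).map φ * (ρ g⁻¹).map φ = 1 := by
    rw [← Matrix.map_mul, rho_mul_inv hρ hρ1, Matrix.map_one _ (map_zero φ) (map_one φ)]
  have hd := congrArg Matrix.det h
  rw [det_mul, det_one] at hd
  -- in `ℤ/2` a unit is `1`
  have key : ∀ x y : ZMod 2, x * y = 1 → x = 1 := by decide
  exact key _ _ hd

/-- **The six residues.** A `2 × 2` matrix over `𝔽₂` with determinant `1` is one of `I, S, U, SU, US, SUS`
(`S = [[0,1],[1,0]]`, `U = [[1,1],[0,1]]`) — i.e. `GL₂(𝔽₂) = ⟨S, U⟩ ≅ S₃`, listed. [folklore] -/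
theorem fin_two_det_one_cases (M : Matrix (Fin 2) (Fin 2) (ZMod 2)) (hM : M.det = 1) :
    M = 1 ∨ M = !![0, 1; 1, 0] ∨ M = !![1, 1; 0, 1] ∨ M = !![0, 1; 1, 1] ∨ M = !![1, 1; 1, 0] ∨
      M = !![1, 0; 1, 1] := by
  rw [det_fin_two] at hM
  have key : ∀ a b c d : ZMod 2, a * d - b * c = 1 →
      (a, b, c, d) = (1, 0, 0, 1) ∨ (a, b, c, d) = (0, 1, 1, 0) ∨ (a, b, c, d) = (1, 1, 0, 1) ∨
        (a, b, c, d) = (0, 1, 1, 1) ∨ (a, b, c, d) = (1, 1, 1, 0) ∨ (a, b, c, d) = (1, 0, 1, 1) := by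
    decide
  have hM' := key (M 0 0) (M 0 1) (M 1 0) (M 1 1) hM
  rw [eta_fin_two M, one_fin_two]
  simp only [Prod.mk.injEq] at hM'
  rcases hM' with ⟨h1, h2, h3, h4⟩ | ⟨h1, h2, h3, h4⟩ | ⟨h1, h2, h3, h4⟩ | ⟨h1, h2, h3, h4⟩ | ⟨h1, h2, h3, h4⟩ |
      ⟨h1, h2, h3, h4⟩ <;>
    simp only [h1, h2, h3, h4, true_or, or_true]

/-- The reductions of the named matrices. [folklore] -/
theorem map_named (hφ2 : φ 2 = 0) :
    (1 : Matrix (Fin 2) (Fin 2) (ZMod (2 ^ m))).map φ = 1 ∧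
    (!![0, 1; 1, 0] : Matrix (Fin 2) (Fin 2) (ZMod (2 ^ m))).map φ = !![0, 1; 1, 0] ∧
    (!![1, 1; 0, 1] : Matrix (Fin 2) (Fin 2) (ZMod (2 ^ m))).map φ = !![1, 1; 0, 1] ∧
    (!![0, 1; 1, 1] : Matrix (Fin 2) (Fin 2) (ZMod (2 ^ m))).map φ = !![0, 1; 1, 1] ∧
    (!![1, 1; 1, 0] : Matrix (Fin 2) (Fin 2) (ZMod (2 ^ m))).map φ = !![1, 1; 1, 0] ∧
    (!![1, 0; 1, 1] : Matrix (Fin 2) (Fin 2) (ZMod (2 ^ m))).map φ = !![1, 0; 1, 1] := by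
  have _ := hφ2
  refine ⟨Matrix.map_one _ (map_zero φ) (map_one φ), ?_, ?_, ?_, ?_, ?_⟩ <;>
  · ext i j; fin_cases i <;> fin_cases j <;> simp

/-- Products of the named matrices over `ℤ/2^m`: `S·U`, `U·S`, `S·U·S`, and the squares `S² = 1`, `U² = 1 + 2·E₁₂`,
and `(SU)³ = 1 + 2·[[0,1],[1,1]]`. [folklore] -/
theorem named_products :
    (!![0, 1; 1, 0] : Matrix (Fin 2) (Fin 2) (ZMod (2 ^ m))) * !![1, 1; 0, 1] = !![0, 1; 1, 1] ∧
    (!![1, 1; 0, 1] : Matrix (Fin 2) (Fin 2) (ZMod (2 ^ m))) * !![0, 1; 1, 0] = !![1, 1; 1, 0] ∧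
    (!![0, 1; 1, 0] : Matrix (Fin 2) (Fin 2) (ZMod (2 ^ m))) * !![1, 1; 0, 1] * !![0, 1; 1, 0] = !![1, 0; 1, 1] ∧
    (!![0, 1; 1, 0] : Matrix (Fin 2) (Fin 2) (ZMod (2 ^ m))) * !![0, 1; 1, 0] = 1 ∧
    (!![1, 1; 0, 1] : Matrix (Fin 2) (Fin 2) (ZMod (2 ^ m))) * !![1, 1; 0, 1] = 1 + (2 : ZMod (2 ^ m)) • !![0, 1; 0, 0] ∧
    (!![0, 1; 1, 1] : Matrix (Fin 2) (Fin 2) (ZMod (2 ^ m))) * !![0, 1; 1, 1] * !![0, 1; 1, 1] =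
      1 + (2 : ZMod (2 ^ m)) • !![0, 1; 1, 1] := by
  refine ⟨?_, ?_, ?_, ?_, ?_, ?_⟩ <;>
  · ext i j; fin_cases i <;> fin_cases j <;> simp [Matrix.mul_apply, Fin.sum_univ_two] <;> ring

end ModTwo

/-! ### §4 The `S₃`-top: a `2`-torsion cocycle vanishing on `Γ(2)` is a coboundary -/

section Top

variable {ρ : Γ → Matrix (Fin 2) (Fin 2) (ZMod (2 ^ m))} {ψ : Γ → Fin 2 → ZMod (2 ^ m)}

/-- A cocycle vanishing at `a` and `b` vanishes at `a * b`. [folklore] -/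
theorem mcocycle_mul_eq_zero (hψ : ∀ g h, ψ (g * h) = ψ g + ρ g *ᵥ ψ h) {a b : Γ} (ha : ψ a = 0)
    (hb : ψ b = 0) : ψ (a * b) = 0 := by
  rw [hψ, ha, hb, mulVec_zero, add_zero]

/-- `2 × 2` matrix-times-vector, written out. [folklore] -/
theorem mulVec_fin_two (M : Matrix (Fin 2) (Fin 2) (ZMod (2 ^ m))) (v : Fin 2 → ZMod (2 ^ m)) :
    M *ᵥ v = ![M 0 0 * v 0 + M 0 1 * v 1, M 1 0 * v 0 + M 1 1 * v 1] := by
  ext i; fin_cases i <;> simp [mulVec, dotProduct, Fin.sum_univ_two]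

/-- **Step (2): `H¹(GL₂(𝔽₂), 𝔽₂²) = 0` at cocycle level.** Let `ψ` be a `2`-torsion-valued matrix cocycle vanishing on
`Γ(2) = {γ : ρ γ ≡ 1 (mod 2)}`, and let `ρ s = S`, `ρ t = U`, with the reduction map `φ` detecting congruences. Then `ψ` is the
coboundary of a `2`-torsion vector: `ψ g = ρ g w − w`. (By hand: `P = ψ s`, `Q = ψ t` satisfy `P + S P = 0`, `Q + U Q = 0`, whence
`w = (P₀ + Q₀, Q₀)`; then `ψ − ∂w` vanishes at `s`, `t`, on `Γ(2)`, hence everywhere by the six residues.)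
[cite: LawsonWuthrich2016, Thm. 1 (p = 2: `H¹(G, E[2]) = 0` for every `G ≤ GL₂(𝔽₂)`)] -/
theorem exists_coboundary_of_vanishes_mod_two (φ : ZMod (2 ^ m) →+* ZMod 2)
    (hφ : ∀ x : ZMod (2 ^ m), φ x = 0 ↔ ∃ c : ZMod (2 ^ m), x = 2 * c)
    (hρ : ∀ g h, ρ (g * h) = ρ g * ρ h) (hρ1 : ρ 1 = 1)
    (hψ : ∀ g h, ψ (g * h) = ψ g + ρ g *ᵥ ψ h) (h2 : ∀ g, (2 : ZMod (2 ^ m)) • ψ g = 0)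
    (hΓ2 : ∀ γ, (∃ C : Matrix (Fin 2) (Fin 2) (ZMod (2 ^ m)), ρ γ = 1 + (2 : ZMod (2 ^ m)) • C) → ψ γ = 0)
    {s t : Γ} (hs : ρ s = !![0, 1; 1, 0]) (ht : ρ t = !![1, 1; 0, 1]) :
    ∃ w : Fin 2 → ZMod (2 ^ m), (2 : ZMod (2 ^ m)) • w = 0 ∧ ∀ g, ψ g = ρ g *ᵥ w - w := by
  obtain ⟨hSU, hUS, hSUS, hSS, hUU, hSU3⟩ := named_products (m := m)
  have hφ2 : φ 2 = 0 := (hφ 2).mpr ⟨1, by ring⟩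
  -- the two relations
  have hP : ψ s + !![0, 1; 1, 0] *ᵥ ψ s = 0 := by
    have h0 : ψ (s * s) = 0 := hΓ2 _ ⟨0, by rw [hρ, hs, hSS, smul_zero, add_zero]⟩
    rwa [hψ, hs] at h0
  have hQ : ψ t + !![1, 1; 0, 1] *ᵥ ψ t = 0 := by
    have h0 : ψ (t * t) = 0 := hΓ2 _ ⟨!![0, 1; 0, 0], by rw [hρ, ht, hUU]⟩
    rwa [hψ, ht] at h0
  have h2s := h2 s
  have h2t := h2 t
  rw [mulVec_fin_two] at hP hQ
  have hP0 := congrFun hP 0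
  have hQ0 := congrFun hQ 0
  have h2s0 := congrFun h2s 0
  have h2s1 := congrFun h2s 1
  have h2t0 := congrFun h2t 0
  simp only [Pi.add_apply, Pi.smul_apply, Pi.zero_apply, smul_eq_mul, of_apply, cons_val', cons_val_zero, cons_val_one,
    cons_val_fin_one, empty_val', zero_mul, one_mul, zero_add, add_zero] at hP0 hQ0 h2s0 h2s1 h2t0
  set w : Fin 2 → ZMod (2 ^ m) := ![ψ s 0 + ψ t 0, ψ t 0] with hw
  have hw2 : (2 : ZMod (2 ^ m)) • w = 0 := by
    ext i; fin_cases i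
    · simp only [hw, Pi.smul_apply, cons_val_zero, smul_eq_mul, Pi.zero_apply, Fin.zero_eta, Fin.isValue]
      linear_combination h2s0 + h2t0
    · simp only [hw, Pi.smul_apply, cons_val_one, cons_val_fin_one, smul_eq_mul, Pi.zero_apply, Fin.mk_one, Fin.isValue]
      linear_combination h2t0
  have hws : ψ s = ρ s *ᵥ w - w := by
    rw [hs, mulVec_fin_two]
    ext i; fin_cases i
    · simp only [hw, Pi.sub_apply, of_apply, cons_val', cons_val_zero, cons_val_one, cons_val_fin_one, empty_val', zero_mul,
        one_mul, zero_add, Fin.zero_eta, Fin.isValue]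
      linear_combination h2s0
    · simp only [hw, Pi.sub_apply, of_apply, cons_val', cons_val_zero, cons_val_one, cons_val_fin_one, empty_val', zero_mul,
        one_mul, add_zero, Fin.mk_one, Fin.isValue]
      linear_combination h2s1 - hP0
  have hwt : ψ t = ρ t *ᵥ w - w := by
    rw [ht, mulVec_fin_two]
    ext i; fin_cases i
    · simp only [hw, Pi.sub_apply, of_apply, cons_val', cons_val_zero, cons_val_one, cons_val_fin_one, empty_val',
        one_mul, Fin.zero_eta, Fin.isValue]
      ring
    · simp only [hw, Pi.sub_apply, of_apply, cons_val', cons_val_zero, cons_val_one, cons_val_fin_one, empty_val', zero_mul,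
        one_mul, zero_add, Fin.mk_one, Fin.isValue]
      linear_combination hQ0 - h2t0
  -- the corrected cocycle `χ = ψ − ∂w`
  set χ : Γ → Fin 2 → ZMod (2 ^ m) := fun g ↦ ψ g - (ρ g *ᵥ w - w) with hχ
  have hχc : ∀ g h, χ (g * h) = χ g + ρ g *ᵥ χ h := fun g h ↦ by
    simp only [hχ, hψ, hρ, ← mulVec_mulVec, mulVec_sub]; abel
  have hχs : χ s = 0 := by simp only [hχ, hws, sub_self]
  have hχt : χ t = 0 := by simp only [hχ, hwt, sub_self]
  have hχ1 : χ 1 = 0 := mcocycle_apply_one hχc hρ1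
  have hχ2 : ∀ γ, (∃ C : Matrix (Fin 2) (Fin 2) (ZMod (2 ^ m)), ρ γ = 1 + (2 : ZMod (2 ^ m)) • C) → χ γ = 0 := by
    rintro γ ⟨C, hC⟩
    simp only [hχ]
    rw [hΓ2 γ ⟨C, hC⟩, hC, add_mulVec, one_mulVec, smul_mulVec, ← mulVec_smul, hw2, mulVec_zero, add_zero, sub_self,
      sub_zero]
  -- transport along a congruence `ρ g ≡ ρ Wd (mod 2)`
  have key : ∀ (g Wd : Γ), χ Wd = 0 →
      (∃ C : Matrix (Fin 2) (Fin 2) (ZMod (2 ^ m)), ρ g = ρ Wd + (2 : ZMod (2 ^ m)) • C) → χ g = 0 := by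
    rintro g Wd hWd ⟨C, hC⟩
    have hmem : ∃ C' : Matrix (Fin 2) (Fin 2) (ZMod (2 ^ m)), ρ (Wd⁻¹ * g) = 1 + (2 : ZMod (2 ^ m)) • C' :=
      ⟨ρ Wd⁻¹ * C, by rw [hρ, hC, mul_add, rho_inv_mul hρ hρ1, Matrix.mul_smul]⟩
    have : g = Wd * (Wd⁻¹ * g) := by group
    rw [this, hχc, hWd, hχ2 _ hmem, mulVec_zero, add_zero]
  obtain ⟨h1, hSm, hUm, hSUm, hUSm, hSUSm⟩ := map_named φ hφ2
  have hχ0 : ∀ g, χ g = 0 := by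
    intro g
    have hdet := det_map_rho_eq_one φ hρ hρ1 g
    rcases fin_two_det_one_cases _ hdet with h | h | h | h | h | h
    · refine key g 1 hχ1 ((map_eq_map_iff φ hφ _ _).mp ?_)
      rw [h, hρ1, h1]
    · refine key g s hχs ((map_eq_map_iff φ hφ _ _).mp ?_)
      rw [h, hs, hSm]
    · refine key g t hχt ((map_eq_map_iff φ hφ _ _).mp ?_)
      rw [h, ht, hUm]
    · refine key g (s * t) (mcocycle_mul_eq_zero hχc hχs hχt) ((map_eq_map_iff φ hφ _ _).mp ?_)
      rw [h, hρ, hs, ht, hSU, hSUm]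
    · refine key g (t * s) (mcocycle_mul_eq_zero hχc hχt hχs) ((map_eq_map_iff φ hφ _ _).mp ?_)
      rw [h, hρ, hs, ht, hUS, hUSm]
    · refine key g (s * t * s) (mcocycle_mul_eq_zero hχc (mcocycle_mul_eq_zero hχc hχs hχt) hχs)
        ((map_eq_map_iff φ hφ _ _).mp ?_)
      rw [h, hρ, hρ, hs, ht, hSUS, hSUSm]
  refine ⟨w, hw2, fun g ↦ ?_⟩
  have := hχ0 g
  simp only [hχ, sub_eq_zero] at this
  exact this

end Top

end Summit.BirchSwinnertonDyer.BirchSwinnertonDyer.Theorems.KolyvaginAtTwo.PhantomMatrix
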